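import Literature.AlgebraicGeometry.Modules.PullbackDualNaturality
import Literature.AlgebraicGeometry.HodgeTheory.HomComplexSupertrace
import HarnessLib

/-!
# The twisted complex along a pull-back: `f^*•(K• ⊗ G) ⟶ f^*•K• ⊗ f^*G` as a chain map

Layer `Literature/AlgebraicGeometry/HodgeTheory`; sequel to `Modules/PullbackDual.lean` ∕ `Modules/PullbackDualNaturality.lean` (the twist
comparison `pullbackTwistComparison f hE G : f^* 𝓗om(E^∨, G) ⟶ 𝓗om((f^*E)^∨, f^*G)`, an isomorphism for `E` finite locally free, natural in
`E` and `G`) and `HomComplexSupertrace.lean` (`HomComplex.twistG X G E = E• ⊗ G`, the twist functor `F ↦ 𝓗om(F^∨, G)` applied termwise).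
For a morphism of schemes `f : X ⟶ Y`, an `𝒪_Y`-module `G` and a cochain complex `K•` of finite locally free `𝒪_Y`-modules:

* **`twistComplexPullbackHom f G K hK : f^*•(K• ⊗ G) ⟶ (f^*•K•) ⊗ f^*G`** — termwise the twist comparison; a chain map by its naturality
  in the first variable (`pullbackTwistComparison_naturality_left`, the differentials of `K• ⊗ G` being `d ⊗ 1`);
* `twistComplexPullbackHom_f` — its components; `isIso_twistComplexPullbackHom_f` — each component is an isomorphism.

This is the complex-level twist comparison `α_q•` that the pull-back twin of `Ventures/HSemireg/HomComplexSupertracePushforward` (step (Q5) of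
the library item (L2) `SigmaPullbackCompat`, crux stmt-HodgeConjecture-26512) composes with `𝓗om•(f^*•K, –)` and the supertrace; for
`G = Ω^q_Y` one further composes with `𝓗om((f^*K)^∨, dq) = twistFunctor.map`-free `sheafHomMap _ (pullbackForms f q)`. Nothing of that crux is
asserted here; everything is proved; no named facts.

## References

* R. Hartshorne, *Algebraic Geometry*, GTM 52 (1977), II Ex. 5.1 (b), (d); II.5 p. 110. [Hartshorne1977]
* U. Görtz, T. Wedhorn, *Algebraic Geometry I*, 2nd ed. (2020), (7.8.3) and Exercise 7.20 (a). [GortzWedhorn2020]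
* C. A. Weibel, *An introduction to homological algebra* (1994), §2.6 (additive functors on complexes, termwise). [Weibel1994]
-/

noncomputable section

-- `TopCat.Presheaf`/`Scheme.Modules` are not reducible (as in Mathlib's `AlgebraicGeometry/Modules/Sheaf.lean`).
set_option backward.isDefEq.respectTransparency false

open CategoryTheory AlgebraicGeometry Opposite TopologicalSpace Limits

universe u

namespace Literature.AlgebraicGeometry.HodgeTheory

open Literature.AlgebraicGeometry.Modules Literature.AlgebraicGeometry.Motives

variable {X Y : Scheme.{u}} (f : X ⟶ Y) (G : Y.Modules) (K : CochainComplex Y.Modules ℤ)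
  (hK : ∀ n, IsFiniteLocallyFree (K.X n))

/-- **`f^*•(K• ⊗ G) ⟶ (f^*•K•) ⊗ f^*G`** as a chain map: termwise the twist comparison `pullbackTwistComparison f (hK n) G`, compatible with
the differentials `d_K ⊗ 1_G` by the naturality of the twist comparison in the first variable.
[cite: Hartshorne1977, II Ex. 5.1 (b) and (d)] [cite: Weibel1994, §2.6] -/
def twistComplexPullbackHom :
    ((Scheme.Modules.pullback f).mapHomologicalComplex (ComplexShape.up ℤ)).obj (HomComplex.twistG Y G K) ⟶
      HomComplex.twistG X ((Scheme.Modules.pullback f).obj G)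
        (((Scheme.Modules.pullback f).mapHomologicalComplex (ComplexShape.up ℤ)).obj K) where
  f n := pullbackTwistComparison f (hK n) G
  comm' i j _ := by
    change pullbackTwistComparison f (hK i) G ≫
        twistMap ((Scheme.Modules.pullback f).map (K.d i j)) ((Scheme.Modules.pullback f).obj G) =
      (Scheme.Modules.pullback f).map (twistMap (K.d i j) G) ≫ pullbackTwistComparison f (hK j) G
    simp only [twistMap, sheafHomPrecomp_eq_sheafHomMapLeft]
    exact (pullbackTwistComparison_naturality_left f (K.d i j) (hK i) (hK j) G).symm

/-- Components of `twistComplexPullbackHom` (definitional). [cite: Hartshorne1977, II Ex. 5.1 (b) and (d)] -/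
@[simp]
theorem twistComplexPullbackHom_f (n : ℤ) :
    (twistComplexPullbackHom f G K hK).f n = pullbackTwistComparison f (hK n) G := rfl

/-- Each component of `twistComplexPullbackHom` is an isomorphism (`isIso_pullbackTwistComparison`). [cite: Hartshorne1977, II Ex. 5.1 (b) and (d)]
[cite: GortzWedhorn2020, (7.8.3) and Exercise 7.20 (a)] -/
theorem isIso_twistComplexPullbackHom_f (n : ℤ) : IsIso ((twistComplexPullbackHom f G K hK).f n) :=
  isIso_pullbackTwistComparison f (hK n) G

/-- Hence `twistComplexPullbackHom` is an isomorphism of complexes. [cite: Hartshorne1977, II Ex. 5.1 (b) and (d)] -/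
theorem isIso_twistComplexPullbackHom : IsIso (twistComplexPullbackHom f G K hK) := by
  haveI := fun n => isIso_twistComplexPullbackHom_f f G K hK n
  exact HomologicalComplex.Hom.isIso_of_components _

/-- **Naturality of `twistComplexPullbackHom` in `G`**: for `g : G ⟶ G'`, `f^*•(K• ⊗ g) ≫ α_{G'} = α_G ≫ (f^*•K•) ⊗ f^*g`
(termwise `pullbackTwistComparison_naturality`; `K• ⊗ g = HomComplex.twistGMap`). [cite: StacksProject, Tag 01CM] -/
theorem twistComplexPullbackHom_naturality {G' : Y.Modules} (g : G ⟶ G') :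
    ((Scheme.Modules.pullback f).mapHomologicalComplex (ComplexShape.up ℤ)).map (HomComplex.twistGMap Y K g) ≫
        twistComplexPullbackHom f G' K hK =
      twistComplexPullbackHom f G K hK ≫
        HomComplex.twistGMap X (((Scheme.Modules.pullback f).mapHomologicalComplex (ComplexShape.up ℤ)).obj K)
          ((Scheme.Modules.pullback f).map g) := by
  refine HomologicalComplex.hom_ext _ _ fun n => ?_
  simp only [HomologicalComplex.comp_f, Functor.mapHomologicalComplex_map_f, NatTrans.mapHomologicalComplex_app_f,
    HomComplex.twistCoeffNatTrans_app, twistComplexPullbackHom_f]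
  exact pullbackTwistComparison_naturality f (hK n) g

end Literature.AlgebraicGeometry.HodgeTheory

end
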